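import Summits.KontsevichZagierPeriods.Zeta5Search.Zudilin2002IntegralityLossless
import Summits.KontsevichZagierPeriods.Zeta5Search.BrickLaurentValuation
import HarnessLib

/-!
# Zudilin 2002's integrality: the centre factor IS the weight — the residual is the first antisymmetric moment of
the CENTRE-FREE kernel `(6,1,0)`, with no lost factor (cell `pub-zeta5`, seat ct-1 g41, sequel)

HONEST FRAMING: systematic search; no irrationality claim unless certified.  `2`-adic bookkeeping of the partial-fraction
cells of the brick kernels `R^{(ε)}_n(t) = n!⁴(t + n/2)^ε(t−n)_n(t+n+1)_n/(t)_{n+1}⁶`, `ε ∈ {0, 1}` (`BrickLaurent.cell 6 1 ε`);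
`ε = 1` is Zudilin's very-well-poised kernel of `rₙ = uₙζ(5) + wₙζ(3) − vₙ` (Mat. Zametki **72** (2002), (7)), `ε = 0` the
plain Ball–Rivoal kernel `R_{6,1}` (`BallRivoal.R 6 1 n`).  Nothing here concerns the arithmetic nature of `ζ(5)`/`ζ(3)`;
records in print UNMOVED; NOTHING IS DISCHARGED (`Zudilin2002.integrality` stays a named fact, net debt 0).

OUR work (Summit side), sequel of `Zudilin2002IntegralityLossless` (same seat), which cut the residual of the named fact to
`ord₂(uₙ), ord₂(D_n²wₙ), ord₂(D_n⁵vₙ) ≥ −1` (`integrality_of_brick_two`).  WHERE does the difficulty sit?  Splitting off the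
centre factor `t + n/2 = (t + K) + (n/2 − K)` pole by pole (`BrickLaurentValuation.laurent_succ_succ`):

* `cell_one_eq` / `cell_one_six` — `c_{K,s} = c̃_{K,s+1} + (n/2 − K)·c̃_{K,s}` (`1 ≤ s ≤ 5`), `c_{K,6} = (n/2 − K)·c̃_{K,6}`,
  `c̃ = cell 6 1 0` the cells of the CENTRE-FREE kernel; hence (`xCoeff_one_eq`, `xZero_one_eq`)
  `uₙ = x̃_6(n) + ½W_5(n)`, `wₙ = x̃_4(n) + ½W_3(n)`, `x_0(n) = U(n) + ½W_0(n)` with the UNWEIGHTED sums `x̃_s = Σ_K c̃_{K,s}`,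
  `U = −Σ_KΣ_{s≤5} c̃_{K,s+1}H_K^{(s)}` and the FIRST ANTISYMMETRIC MOMENTS
  `W_s(n) := Σ_K (n − 2K)·c̃_{K,s}(n)` (`s = 5, 3`), `W_0(n) := Σ_K (n − 2K)·c̃⁰_K(n)` (`c̃⁰_K = −Σ_s c̃_{K,s}H_K^{(s)}`);
* `brickKernel_zero_eq_R`, `cell_zero_isInt` — the centre-free kernel is `BallRivoal.R 6 1 n` (a product of six bricks), so
  by Rivoal's Lemme 5 (`BallRivoal.exists_pf_R`, `pf_unique`) its cells have the NAIVE denominators `D_n^{6−s}c̃_{K,s} ∈ ℤ`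
  — with NO factor `2`: the unweighted sums are `2`-integral at the printed exponents TERMWISE
  (`x̃_6 ∈ ℤ`, `D_n²x̃_4 ∈ ℤ`, `D_n⁵U ∈ ℤ`: `padicValuation_xCoeff_zero_le`, `padicValuation_U_le`);
* **`integrality_of_moments`** — therefore **`Zudilin2002.integrality` ⇐ `W_5(n) ∈ ℤ₍₂₎ ∧ D_n²W_3(n) ∈ ℤ₍₂₎ ∧
  D_n⁵W_0(n) ∈ ℤ₍₂₎` for all `n`**: the whole residual is the Krattenthaler–Rivoal `d_n`-saving at the prime `2` for the
  first `(n − 2K)`-moment of the PLAIN kernel `R_{6,1}` — no centre factor, NO lost factor `2` (the `½` of `t + n/2` is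
  exactly paid by the naive integrality of the unweighted part);
* **`integrality_of_propositionH_two`** — in the cell's vocabulary this hypothesis is VERBATIM the conclusion of zi-eng's
  `BrickPropositionHInf.propositionH_inf` (proved there for every ODD prime, every level, every admissible weight) at
  `p = 2`, `(A,B) = (6,1)`, kernel `ε = 0`, for the ONE weight `g(k) = n − 2k` (integral; `g(n−k) + g(k) = 0` exactly;
  `g(k′) − g(k) = 2(k − k′)`): `v₂(Σ_k (n−2k)·2^{ℓ(6−s)}c̃_{k,s}(n)) ≤ exp(−ℓ)` (all `s`) and the harmonic cell, `n < 2^{ℓ+1}`.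

So what is left of the named fact is `propositionH_inf` minus its hypothesis `p ≠ 2`, for one kernel and one weight.
DATA (seat desk `alg/centre_free_cells.py`, exact, `n ≤ 9`; not used by the kernel): the relations and the naive bounds
hold; `x̃_5 = x̃_3 = x̃_1 = 0` (parity of the plain kernel); `ord₂(W_5) = ord₂(D_n²W_3) = ord₂(D_n⁵W_0) = 1` EXACTLY while
the unweighted parts are EVEN (`ord₂ ≥ 1`) — the observed oddness of `uₙ, D_n²wₙ, D_n⁵vₙ` (ct-1 g39) is `½W` being odd;
`uₙ = 9, 469, 38601, 4008501, 476698509, …` reproduced from the decomposition.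
-/

noncomputable section

open WithZero Finset

namespace Summit.KontsevichZagierPeriods.Zeta5Search.Zudilin2002IntegralityCentreFree

open Literature.NumberTheory.Irrationality.Zudilin2002 (integrality)
open Literature.NumberTheory.Transcendental (BallRivoal.R BallRivoal.pfEval BallRivoal.poch BallRivoal.IsInt
  BallRivoal.exists_pf_R BallRivoal.pf_unique BallRivoal.pfEval_sub' BallRivoal.harm BallRivoal.isInt_dpow_mul_harm)
open Summit.KontsevichZagierPeriods.Zeta5Search.BrickKernelFrobenius (brickKernel)
open Summit.KontsevichZagierPeriods.Zeta5Search.BrickLaurent (cell laurent)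
open Summit.KontsevichZagierPeriods.Zeta5Search.BrickLaurentValuation (laurent_succ_succ laurent_succ_zero)
open Summit.KontsevichZagierPeriods.Zeta5Search.BrickPartialFractions (xCoeff xZero cellZero)
open Summit.KontsevichZagierPeriods.Zeta5Search.BrickLinearForms (pfEval_cell poch_sub_natCast poch_add_natCast_succ)
open Summit.KontsevichZagierPeriods.Zeta5Search.BrickDenominators (le_exp_of_pow_mul_le padicValuation_lcmUpto)
open Summit.KontsevichZagierPeriods.Zeta5Search.Zudilin2002IntegralityTwoAdic (padicValuation_intCast_le_one)
open Summit.KontsevichZagierPeriods.Zeta5Search.Zudilin2002IntegralityLossless (integrality_of_brick_two)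

/-! ### The centre factor, pole by pole -/

/-- **`c_{K,s} = c̃_{K,s+1} + (n/2 − K)·c̃_{K,s}`** for `1 ≤ s ≤ 5`: the cell of the very-well-poised kernel `(6,1,1)` at the
pole `−K`, order `s`, against the cells `c̃ = cell 6 1 0` of the centre-free kernel (`t + n/2 = (t+K) + (n/2 − K)`). -/
theorem cell_one_eq (n K : ℕ) {s : ℕ} (hs1 : 1 ≤ s) (hs : s ≤ 5) :
    cell 6 1 1 n K s = cell 6 1 0 n K (s + 1) + ((n : ℚ) / 2 - K) * cell 6 1 0 n K s := by
  obtain ⟨d, hd⟩ : ∃ d, 6 - s = d + 1 := ⟨5 - s, by omega⟩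
  have h := laurent_succ_succ 6 1 0 n K d
  rw [zero_add] at h
  rw [cell, cell, cell, hd, show 6 - (s + 1) = d by omega, h]

/-- **`c_{K,6} = (n/2 − K)·c̃_{K,6}`** (order `6`: the centre factor only shifts). -/
theorem cell_one_six (n K : ℕ) : cell 6 1 1 n K 6 = ((n : ℚ) / 2 - K) * cell 6 1 0 n K 6 := by
  have h := laurent_succ_zero 6 1 0 n K
  rw [zero_add] at h
  rw [cell, cell, Nat.sub_self, h]

/-- **`x_s(n) = x̃_{s+1}(n) + ½·W_s(n)`**, `W_s(n) = Σ_K (n − 2K)·c̃_{K,s}(n)` (`1 ≤ s ≤ 5`): in particular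
`uₙ = x̃_6 + ½W_5`, `wₙ = x̃_4 + ½W_3`. -/
theorem xCoeff_one_eq (n : ℕ) {s : ℕ} (hs1 : 1 ≤ s) (hs : s ≤ 5) :
    xCoeff 6 1 1 n s = xCoeff 6 1 0 n (s + 1) +
      (1 / 2) * ∑ K ∈ range (n + 1), ((n : ℚ) - 2 * K) * cell 6 1 0 n K s := by
  rw [xCoeff, xCoeff, mul_sum, ← sum_add_distrib]
  refine sum_congr rfl fun K _ => ?_
  rw [cell_one_eq n K hs1 hs]; ring

/-- The unweighted part of the harmonic cell: `U_K(n) := −Σ_{s=1}^{5} c̃_{K,s+1}(n)·H_K^{(s)}`. (An abbreviation inside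
statements only; no definition is introduced.) **`c⁰_K = U_K + (n/2 − K)·c̃⁰_K`** for the harmonic cells of the two kernels. -/
theorem cellZero_one_eq (n K : ℕ) :
    cellZero 6 1 1 n K =
      -(∑ s ∈ Icc 1 5, cell 6 1 0 n K (s + 1) * ∑ i ∈ Icc 1 K, 1 / (i : ℚ) ^ s) +
        ((n : ℚ) / 2 - K) * cellZero 6 1 0 n K := by
  rw [cellZero, cellZero]
  have h6 : Icc 1 6 = insert 6 (Icc 1 5) := by decide
  rw [h6, sum_insert (by decide), sum_insert (by decide), cell_one_six]
  have hrest : ∑ s ∈ Icc 1 5, cell 6 1 1 n K s * ∑ i ∈ Icc 1 K, 1 / (i : ℚ) ^ s =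
      ∑ s ∈ Icc 1 5, cell 6 1 0 n K (s + 1) * ∑ i ∈ Icc 1 K, 1 / (i : ℚ) ^ s +
        ((n : ℚ) / 2 - K) * ∑ s ∈ Icc 1 5, cell 6 1 0 n K s * ∑ i ∈ Icc 1 K, 1 / (i : ℚ) ^ s := by
    rw [mul_sum, ← sum_add_distrib]
    refine sum_congr rfl fun s hs => ?_
    have hs' := mem_Icc.1 hs
    rw [cell_one_eq n K hs'.1 hs'.2]; ring
  rw [hrest]; ring

/-- **`x_0(n) = U(n) + ½·W_0(n)`** with `U = Σ_K U_K`, `W_0 = Σ_K (n − 2K)·c̃⁰_K`. -/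
theorem xZero_one_eq (n : ℕ) :
    xZero 6 1 1 n =
      -(∑ K ∈ range (n + 1), ∑ s ∈ Icc 1 5, cell 6 1 0 n K (s + 1) * ∑ i ∈ Icc 1 K, 1 / (i : ℚ) ^ s) +
        (1 / 2) * ∑ K ∈ range (n + 1), ((n : ℚ) - 2 * K) * cellZero 6 1 0 n K := by
  rw [xZero, mul_sum, ← sum_neg_distrib, ← sum_add_distrib]
  refine sum_congr rfl fun K _ => ?_
  rw [cellZero_one_eq]; ring

/-! ### The centre-free kernel is Ball–Rivoal's `R_{6,1}`: naive denominators of its cells -/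

/-- **The centre-free brick kernel `(6,1,0)` is `BallRivoal.R 6 1 n`** (variable shift `k = t + 1`):
`n!⁴(k−n)_n(k+n+1)_n/(k)_{n+1}⁶`. -/
theorem brickKernel_zero_eq_R (n : ℕ) (t : ℚ) : brickKernel 6 1 0 n (t + 1) = BallRivoal.R 6 1 n t := by
  rw [brickKernel, BallRivoal.R, one_mul, pow_zero, mul_one, pow_one, pow_one, Nat.cast_one, one_mul,
    show t - (n : ℚ) + 1 = (t + 1) - n by ring, poch_sub_natCast,
    show t + (n : ℚ) + 2 = (t + 1) + n + 1 by ring, poch_add_natCast_succ, BallRivoal.poch]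

/-- **Naive denominators of the centre-free cells**: `D_n^{5−o}·c̃_{K,o+1}(n) ∈ ℤ` for `o < 6`, `K ≤ n` (`D_n = lcm(1,…,n)`) —
Rivoal's Lemme 5 for the six-brick product `R_{6,1}` (`BallRivoal.exists_pf_R`), transferred to the tree's cells by the
uniqueness of partial fractions (`BallRivoal.pf_unique`, `BrickLinearForms.pfEval_cell`).  NO factor `2` appears: the
centre-free kernel has integer brick residues. -/
theorem cell_zero_isInt (n : ℕ) {o K : ℕ} (ho : o < 6) (hK : K ≤ n) :
    ∃ z : ℤ, ((Nat.lcmUpto n : ℕ) : ℚ) ^ (6 - 1 - o) * cell 6 1 0 n K (o + 1) = z := by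
  obtain ⟨c, hc, hint, -⟩ := BallRivoal.exists_pf_R 6 1 n (Nat.lcmUpto n) (by norm_num) (by norm_num)
    (fun k h1 h2 => by
      rw [Int.natCast_dvd_natCast, Nat.lcmUpto]
      exact Finset.dvd_lcm (Finset.mem_Icc.2 ⟨h1, h2⟩))
  have heq : c o K = cell 6 1 0 n K (o + 1) := by
    have h0 := BallRivoal.pf_unique n 6 (fun o p => c o p - cell 6 1 0 n p (o + 1)) 0 (fun t _ => ?_) o K ho hK
    · exact sub_eq_zero.1 h0
    · have hne : ∀ m : ℕ, m ≤ n → (t : ℚ) + m + 1 ≠ 0 := fun m _ => by positivity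
      rw [BallRivoal.pfEval_sub', hc t hne, pfEval_cell (A := 6) (B := 1) (by norm_num) (by norm_num) n hne,
        brickKernel_zero_eq_R, sub_self]
  obtain ⟨z, hz⟩ := hint o K
  exact ⟨z, by rw [← heq, ← hz]⟩

/-- `D_n^{6−s}·c̃_{K,s}(n)` is an integer (`1 ≤ s ≤ 6`, `K ≤ n`); as a `2`-adic bound: `v₂(D_n^{6−s}c̃_{K,s}) ≤ 1`. -/
theorem padicValuation_cell_zero_le (n : ℕ) {s K : ℕ} (hs1 : 1 ≤ s) (hs : s ≤ 6) (hK : K ≤ n) :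
    Rat.padicValuation 2 (((Nat.lcmUpto n : ℕ) : ℚ) ^ (6 - s) * cell 6 1 0 n K s) ≤ 1 := by
  obtain ⟨z, hz⟩ := cell_zero_isInt n (o := s - 1) (by omega) hK
  rw [show 6 - 1 - (s - 1) = 6 - s by omega, Nat.sub_add_cancel hs1] at hz
  rw [hz]
  exact padicValuation_intCast_le_one 2 z

/-- `D_n^s·H_K^{(s)} ∈ ℤ` for `K ≤ n` (`H_K^{(s)} = Σ_{i=1}^{K} i^{−s}`), as a `2`-adic bound. [folklore] -/
theorem padicValuation_harmonic_le (n : ℕ) {K : ℕ} (hK : K ≤ n) (s : ℕ) :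
    Rat.padicValuation 2 (((Nat.lcmUpto n : ℕ) : ℚ) ^ s * ∑ i ∈ Icc 1 K, 1 / (i : ℚ) ^ s) ≤ 1 := by
  have hh : ∑ i ∈ Icc 1 K, 1 / (i : ℚ) ^ s = BallRivoal.harm s K := by
    rw [BallRivoal.harm, ← Finset.Ico_add_one_right_eq_Icc, Finset.sum_Ico_eq_sum_range, Nat.add_sub_cancel]
    refine sum_congr rfl fun m _ => ?_
    push_cast; ring_nf
  obtain ⟨z, hz⟩ := BallRivoal.isInt_dpow_mul_harm n (Nat.lcmUpto n)
    (fun k h1 h2 => by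
      rw [Int.natCast_dvd_natCast, Nat.lcmUpto]
      exact Finset.dvd_lcm (Finset.mem_Icc.2 ⟨h1, h2⟩)) s K hK
  rw [hh, hz]
  exact padicValuation_intCast_le_one 2 z

/-- **The unweighted sums are `2`-integral at the naive exponents, termwise**: `v₂(D_n^{6−s}·x̃_s(n)) ≤ 1` (`1 ≤ s ≤ 6`). -/
theorem padicValuation_xCoeff_zero_le (n : ℕ) {s : ℕ} (hs1 : 1 ≤ s) (hs : s ≤ 6) :
    Rat.padicValuation 2 (((Nat.lcmUpto n : ℕ) : ℚ) ^ (6 - s) * xCoeff 6 1 0 n s) ≤ 1 := by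
  rw [xCoeff, mul_sum]
  refine Valuation.map_sum_le _ fun K hK => ?_
  exact padicValuation_cell_zero_le n hs1 hs (by have := mem_range.1 hK; omega)

/-- **The unweighted harmonic part is `2`-integral at the naive exponent, termwise**: `v₂(D_n⁵·U(n)) ≤ 1`,
`U = −Σ_KΣ_{s≤5} c̃_{K,s+1}H_K^{(s)}` (`D_n⁵ = D_n^{5−s}·D_n^s`). -/
theorem padicValuation_U_le (n : ℕ) :
    Rat.padicValuation 2 (((Nat.lcmUpto n : ℕ) : ℚ) ^ 5 *
      -(∑ K ∈ range (n + 1), ∑ s ∈ Icc 1 5, cell 6 1 0 n K (s + 1) * ∑ i ∈ Icc 1 K, 1 / (i : ℚ) ^ s)) ≤ 1 := by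
  rw [mul_neg, Valuation.map_neg, mul_sum]
  refine Valuation.map_sum_le _ fun K hK => ?_
  have hKn : K ≤ n := by have := mem_range.1 hK; omega
  rw [mul_sum]
  refine Valuation.map_sum_le _ fun s hs => ?_
  have hs' := mem_Icc.1 hs
  set D : ℚ := ((Nat.lcmUpto n : ℕ) : ℚ)
  rw [show D ^ 5 * (cell 6 1 0 n K (s + 1) * ∑ i ∈ Icc 1 K, 1 / (i : ℚ) ^ s) =
      (D ^ (6 - (s + 1)) * cell 6 1 0 n K (s + 1)) * (D ^ s * ∑ i ∈ Icc 1 K, 1 / (i : ℚ) ^ s) by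
    rw [show (5 : ℕ) = (6 - (s + 1)) + s by omega, pow_add]; ring, map_mul]
  exact mul_le_one' (padicValuation_cell_zero_le n (by omega) (by omega) hKn) (padicValuation_harmonic_le n hKn s)

/-! ### The residual is the first antisymmetric moment of the centre-free kernel -/

/-- `v₂(½·y) ≤ exp 1` from `v₂(y) ≤ 1`. [folklore] -/
private theorem padicValuation_half_mul_le {y : ℚ} (h : Rat.padicValuation 2 y ≤ 1) :
    Rat.padicValuation 2 ((1 / 2) * y) ≤ exp 1 := by
  rw [map_mul, map_div₀, map_one, show (2 : ℚ) = ((2 : ℕ) : ℚ) by norm_num, Rat.padicValuation_self, one_div,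
    ← exp_neg, neg_neg]
  calc exp 1 * Rat.padicValuation 2 y ≤ exp 1 * 1 := mul_le_mul' le_rfl h
    _ = exp 1 := mul_one _

/-- **`Zudilin2002.integrality` from the `2`-integrality of the three first moments of the CENTRE-FREE kernel.**  If for
every `n` (`c̃ = cell 6 1 0 n`, `c̃⁰ = cellZero 6 1 0 n`, `D_n = lcm(1,…,n)`)
`W_5(n) = Σ_K (n−2K)c̃_{K,5} ∈ ℤ₍₂₎`, `D_n²·W_3(n) = D_n²Σ_K (n−2K)c̃_{K,3} ∈ ℤ₍₂₎` and `D_n⁵·W_0(n) = D_n⁵Σ_K (n−2K)c̃⁰_K ∈ ℤ₍₂₎`,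
then `4D_n²qₙ, 4D_n⁷pₙ, 4D_n⁵p̃ₙ ∈ ℤ` for all `n ≥ 1`.  (`uₙ = x̃_6 + ½W_5` etc.; the unweighted parts are `2`-integral at the
needed exponents by Rivoal's Lemme 5, so `ord₂(uₙ), ord₂(D_n²wₙ), ord₂(D_n⁵vₙ) ≥ −1`, and `integrality_of_brick_two`.)
The hypothesis is the Krattenthaler–Rivoal `d_n`-saving at `p = 2` for the FIRST `(n−2K)`-MOMENT of the plain kernel
`R_{6,1}` — no centre factor and NO lost factor `2`. [cite: Zudilin2002Zeta5, Sect. 2 (7), (14)–(15)] -/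
theorem integrality_of_moments
    (h : ∀ n : ℕ,
      Rat.padicValuation 2 (∑ K ∈ range (n + 1), ((n : ℚ) - 2 * K) * cell 6 1 0 n K 5) ≤ 1 ∧
        Rat.padicValuation 2 (((Nat.lcmUpto n : ℕ) : ℚ) ^ 2 *
          ∑ K ∈ range (n + 1), ((n : ℚ) - 2 * K) * cell 6 1 0 n K 3) ≤ 1 ∧
        Rat.padicValuation 2 (((Nat.lcmUpto n : ℕ) : ℚ) ^ 5 *
          ∑ K ∈ range (n + 1), ((n : ℚ) - 2 * K) * cellZero 6 1 0 n K) ≤ 1) :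
    integrality := by
  refine integrality_of_brick_two fun n => ?_
  obtain ⟨h5, h3, h0⟩ := h n
  have one_le : (1 : ℤᵐ⁰) ≤ exp 1 := by rw [← exp_zero]; exact exp_le_exp.2 (by norm_num)
  refine ⟨?_, ?_, ?_⟩
  · rw [xCoeff_one_eq n (by norm_num) (by norm_num)]
    refine (Valuation.map_add _ _ _).trans (max_le ?_ (padicValuation_half_mul_le h5))
    have := padicValuation_xCoeff_zero_le n (s := 6) (by norm_num) le_rfl
    rw [Nat.sub_self, pow_zero, one_mul] at this
    exact this.trans one_le
  · rw [xCoeff_one_eq n (by norm_num) (by norm_num), mul_add, ← mul_assoc, mul_comm (_ ^ 2) (1 / 2 : ℚ), mul_assoc]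
    refine (Valuation.map_add _ _ _).trans (max_le ?_ (padicValuation_half_mul_le h3))
    exact (padicValuation_xCoeff_zero_le n (s := 4) (by norm_num) (by norm_num)).trans one_le
  · rw [xZero_one_eq n, mul_add, ← mul_assoc (_ ^ 5), mul_comm (_ ^ 5) (1 / 2 : ℚ), mul_assoc]
    refine (Valuation.map_add _ _ _).trans (max_le ?_ (padicValuation_half_mul_le h0))
    exact (padicValuation_U_le n).trans one_le

/-- **PROPOSITION H^∞ at `p = 2` for the ONE weight `n − 2k` closes the named fact.**  If for every level `ℓ` and every
`n < 2^{ℓ+1}`: `v₂(Σ_{k≤n} (n−2k)·2^{ℓ(6−s)}c̃_{k,s}(n)) ≤ exp(−ℓ)` for every `s` and `v₂(Σ_{k≤n} (n−2k)·2^{6ℓ}c̃⁰_k(n)) ≤ exp(−ℓ)`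
— VERBATIM the conclusion of `BrickPropositionHInf.propositionH_inf` (proved in the tree for every ODD prime `p`) at `p = 2`,
`(A,B) = (6,1)`, kernel `ε = 0`, weight `g(k) = n − 2k` (which is integral, satisfies `g(n−k) + g(k) = 0` exactly and
`g(k′) − g(k) = 2(k − k′)`) — then `Zudilin2002.integrality`.  (`ℓ = ⌊log₂ n⌋`, `v₂(D_n) = exp(−ℓ)`; `integrality_of_moments`.)
[cite: Zudilin2002Zeta5, Sect. 2 (7), (14)–(15)] -/
theorem integrality_of_propositionH_two
    (h : ∀ ℓ n : ℕ, n < 2 ^ (ℓ + 1) →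
      (∀ s, Rat.padicValuation 2 (∑ k ∈ range (n + 1),
          ((n : ℚ) - 2 * k) * ((2 : ℚ) ^ (ℓ * (6 - s)) * cell 6 1 0 n k s)) ≤ exp (-(ℓ : ℤ))) ∧
        Rat.padicValuation 2 (∑ k ∈ range (n + 1),
          ((n : ℚ) - 2 * k) * ((2 : ℚ) ^ (ℓ * 6) * cellZero 6 1 0 n k)) ≤ exp (-(ℓ : ℤ))) :
    integrality := by
  haveI : Fact (Nat.Prime 2) := ⟨Nat.prime_two⟩
  refine integrality_of_moments fun n => ?_
  set ℓ : ℕ := Nat.log 2 n with hℓ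
  have hn : n < 2 ^ (ℓ + 1) := Nat.lt_pow_succ_log_self (by norm_num) n
  obtain ⟨hs, h0⟩ := h ℓ n hn
  have hD : Rat.padicValuation 2 (((Nat.lcmUpto n : ℕ) : ℚ)) = exp (-(ℓ : ℤ)) := by
    rw [hℓ]; exact padicValuation_lcmUpto (p := 2) n
  -- pull the normalisation out of the weighted sum, then trade `2^{ℓ j}` for `D_n^j`
  have pull : ∀ (f : ℕ → ℚ) (e : ℕ), ∑ k ∈ range (n + 1), ((n : ℚ) - 2 * k) * ((2 : ℚ) ^ e * f k) =
      (2 : ℚ) ^ e * ∑ k ∈ range (n + 1), ((n : ℚ) - 2 * k) * f k := fun f e => by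
    rw [mul_sum]; exact sum_congr rfl fun k _ => by ring
  have conv : ∀ (y : ℚ) (j e : ℕ), e = ℓ * (j + 1) →
      Rat.padicValuation 2 ((2 : ℚ) ^ e * y) ≤ exp (-(ℓ : ℤ)) →
        Rat.padicValuation 2 (((Nat.lcmUpto n : ℕ) : ℚ) ^ j * y) ≤ 1 := by
    intro y j e he hy
    subst he
    rw [show (2 : ℚ) = ((2 : ℕ) : ℚ) by norm_num] at hy
    have hy' := le_exp_of_pow_mul_le (p := 2) hy
    rw [map_mul, map_pow, hD, ← exp_nsmul, nsmul_eq_mul]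
    calc exp ((j : ℤ) * -(ℓ : ℤ)) * Rat.padicValuation 2 y
        ≤ exp ((j : ℤ) * -(ℓ : ℤ)) * exp (((ℓ * (j + 1) : ℕ) : ℤ) - (ℓ : ℤ)) := mul_le_mul' le_rfl hy'
      _ = 1 := by rw [← exp_add, ← exp_zero]; congr 1; push_cast; ring
  refine ⟨?_, ?_, ?_⟩
  · have h5 := hs 5
    rw [pull] at h5
    have := conv _ 0 _ (by norm_num) h5
    rwa [pow_zero, one_mul] at this
  · have h3 := hs 3
    rw [pull] at h3
    exact conv _ 2 _ (by norm_num) h3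
  · rw [pull] at h0
    exact conv _ 5 _ (by ring) h0

end Summit.KontsevichZagierPeriods.Zeta5Search.Zudilin2002IntegralityCentreFree
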